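import Summits.QuantumFields.YangMills.Theorems.BalabanUVNodesN15KingModelSlicesExactMassGrad
import Summits.QuantumFields.YangMills.Theorems.BalabanUVNodesN15KingModelFullPropagatorMixedProfile

/-!
# BalabanUVNodes ∕ N15 — THE KING-MODEL RUNG, CURVED EDITION (PART Φ-a): THE TWO-SPACING η-RATE OF THE DOUBLY DIFFERENTIATED SLICE —
# `|Σ_w(Σ_z ∂^{η′}_μℋ′(x′,z)C′(z,w))∂^{η′}_νℋ′(y′,w) − Σ_w(Σ_z ∂^η_μℋ(x,z)C(z,w))∂^η_νℋ(y,w)| ≤ C·(L^{−γ∕2})^j·e^{−δ|B(x) − B(y)|_U}` (`x = πx′`, `y = πy′`),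
# King's (3.73) with `|a| = |b| = 1` for the `A = 0` single-scale pieces of (2.17), ONE `(C, δ)` for all masses `0 < m² ≤ m₀²`, all indices and volumes
# (Track A, DAG node N15 = NE2; FAN-OUT v1.1 §N15 s3 «KING-MODEL RUNG … + the one-line statement of what the curved case adds»)

HONEST FRAMING.  Count-neutral kernel bookkeeping (cell `pub-ymgap`, seat `pub-ymgap-dag-n15-e` g10; `--supports stmt-QuantumFields-20544 --as helper` = K3⁷
`SpineGivenEndpointR13SepCoPH`, WORDS-143).  TEMPLATE LITERATURE, `A = 0`: C. King's scalar U(1)-Higgs MODEL on finite tori ([King1986] (2.13)–(2.17) p. 653,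
Prop. 3.8 (3.71) p. 664, Prop. 3.9 (3.73) p. 665 «`|D^a_{x′}D^b_{y′}G^{η′}_{(j)}(x′, y′) − D^a_xD^b_yG^η_{(j)}(x, y)| ≤ C(L^{−γk})(L^jη)^{2−d−|a|−|b|−γ}exp[−δ₀(L^jη)^{−1}|x − y|]`»,
(4.42)–(4.43) p. 675), NOT Bałaban's covariant objects.  Parts M ∕ M′ proved the `(a, b) = (0, 0)` and `(1, 0)` slice rates (`ksSlice_rate_unif`, `ksDSlice_rate_unif`);
THIS FILE proves the `|a| = |b| = 1` slice rate — the input of the sequel's paired peel induction for the MIXED second difference of the FULL `A = 0`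
propagator (the kernel of [B9]'s (3.44)∕(3.45) objects) at two spacings.  Decided in the MODEL (King's slices, A = 0); NOT a printed proposition beyond
the quoted template; NE2⁺ is NOT PRINTED and not proved; NOT a node discharge; nothing continuum ∕ ℝ⁴ ∕ OS ∕ mass-gap ∕ Clay.  0 `sorry`, 0 `def`, standard axioms.
* `ksDDSlice'_eq` (the fine twin of part V-a `ksDDSlice_eq`: `L^nL^j·[ksDSlice′_μ(x′, y′ + e_ν) − ksDSlice′_μ(x′, y′)] = Σ_w(Σ_z ∂′ℋ′(x′,z)C′(z,w))∂′ℋ′(y′,w)`);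
* ★ **`ksDDSlice_rate_unif`** — `0 ≤ γ < 1`: `∃ C δ > 0 ∀ 0 < m² ≤ m₀² ∀ i μ ν x′ y′`,
  `|triple (∂′ℋ′_μ x′) C′ (∂′ℋ′_ν y′) − triple (∂ℋ_μ x) C (∂ℋ_ν y)| ≤ C·(L^{−γ∕2})^j·e^{−δ|B(x) − B(y)|_U}` — part F₀ `triple_rate` with BOTH outer legs
  differentiated: decay ∕ rate of `∂ℋ` from part M′ `ksDH_decay_unif` ∕ `ksDH_rate_unif` (King's (3.71) second line, mass-uniform), of `C^{(j)}` from n15-d's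
  `kingCov_abs_le` ∕ King's Lemma 4.5 (`ksC_decay`, `ksC_rate`).
WHAT THE CURVED CASE ADDS (one line): the same rate for the slices of Bałaban's `G_k(U)` (B9 Sect. D), uniformly over `Reg335` — not printed as an η-difference.
HONEST SCOPE.  (i) `A = 0`, periodic b.c., odd `L ≥ 3`, volumes `fine L (2L^e)`, `j, n ≥ 1`, `0 < m² ≤ m₀²`, `0 ≤ γ < 1`; (ii) lattice units (part F's
conventions), sup torus distance, forward η-differences; (iii) not Bałaban's `G_k(U)`; not a discharge.
Locators: [King1986] (2.13)–(2.17) p. 653, (2.20) p. 654, Prop. 3.8 (3.71) p. 664, Prop. 3.9 (3.73) p. 665, Lemma 4.5 (4.38) p. 674, (4.42)–(4.43) p. 675.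
-/

noncomputable section

namespace Summit.QuantumFields.YangMills.BalabanUVNodes.N15KingModelRung.Curved

open Real Finset Matrix
open Literature.MathematicalPhysics.QuantumFieldTheory.Balaban1983to89.B4Sect5Proof (latticeConst)
open Literature.MathematicalPhysics.QuantumFieldTheory.Balaban1983to89.B5Prop11Plancherel (Tor fine unitVec)
open Literature.MathematicalPhysics.QuantumFieldTheory.King1986 (aK aK_le aK_pos)
open Literature.MathematicalPhysics.QuantumFieldTheory.King1986.Torus (blockOf tdistT tdistT_triangle tdistT_nonneg tdistT_symm
  tdistT_sumBound gam0L kapCT K45 delta45 K45_nonneg delta45_pos kapCT_pos_le)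
open Summit.QuantumFields.YangMills.BalabanUVNodes.N15.KingModel (kingRho kingRhoB)

variable {d : ℕ} (L : ℕ) [NeZero L]

/-- **THE DOUBLY DIFFERENTIATED SLICE OF THE FINE RUN**: `L^nL^j·[ksDSlice′_μ(x′, y′ + e_ν) − ksDSlice′_μ(x′, y′)] = Σ_w(Σ_z ∂^{η′}_μℋ′(x′, z)·C′(z, w))·∂^{η′}_νℋ′(y′, w)`
— the fine twin of part V-a `ksDDSlice_eq` (part H's `ksDH′` by `rfl`). [cite: King1986, (4.42) p.675, Prop. 3.9 (3.73) p.665 (object `D^a_{x′}D^b_{y′}G^{η′}_{(j)}`)] -/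
theorem ksDDSlice'_eq (a m2 : ℝ) (i : KSliceIdx d) (μ ν : Fin (d + 1)) (x' y' : Tor (fine (L ^ i.n * L ^ i.j) (ksU L i))) :
    ((L ^ i.n * L ^ i.j : ℕ) : ℝ) * (ksDSlice' L a m2 i μ x' (y' + unitVec (fine (L ^ i.n * L ^ i.j) (ksU L i)) ν) - ksDSlice' L a m2 i μ x' y')
      = triple (ksDH' L a m2 i μ x') (ksC' L a m2 i) (ksDH' L a m2 i ν y') := by
  rw [ksDSlice', ksDSlice', ← triple_sub_right, ← triple_smul_right]
  rfl

set_option maxHeartbeats 400000 in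
/-- ★ **THE TWO-SPACING η-RATE OF THE DOUBLY DIFFERENTIATED SLICE, ONE `(C, δ)` FOR ALL MASSES `0 < m² ≤ m₀²`** — King's (3.73) with `|a| = |b| = 1` for the
`A = 0` single-scale pieces: for `0 ≤ γ < 1`, every `0 < m² ≤ m₀²`, index, directions `μ, ν` and all fine `x′, y′` over `x, y` (King's pairing `underPtN`),
`|Σ_w(Σ_z ∂′ℋ′_μ(x′,z)C′(z,w))∂′ℋ′_ν(y′,w) − Σ_w(Σ_z ∂ℋ_μ(x,z)C(z,w))∂ℋ_ν(y,w)| ≤ C·(L^{−γ∕2})^j·e^{−δ|B(x) − B(y)|_U}` — part F₀ `triple_rate` with both outer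
legs differentiated (decay and rate of `∂ℋ` from part M′ `ksDH_decay_unif` ∕ `ksDH_rate_unif`, of `C^{(j)}` from `ksC_decay` ∕ `ksC_rate`), at the common rate.
[cite: King1986, Prop. 3.9 (3.73) p.665, Prop. 3.8 (3.71) p.664 (second line), Lemma 4.5 (4.38) p.674, (4.42)–(4.43) p.675, (2.20) p.654] -/
theorem ksDDSlice_rate_unif (hLodd : Odd L) (hL : 2 ≤ L) {a : ℝ} (ha : 0 < a) {m0sq : ℝ} (hm0 : 0 ≤ m0sq) {γ : ℝ} (hγ0 : 0 ≤ γ)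
    (hγ1 : γ < 1) :
    ∃ C δ : ℝ, 0 < C ∧ 0 < δ ∧ ∀ (m2 : ℝ), 0 < m2 → m2 ≤ m0sq →
      ∀ (i : KSliceIdx d) (μ ν : Fin (d + 1)) (x' y' : Tor (fine (L ^ i.n * L ^ i.j) (ksU L i))),
      |triple (ksDH' L a m2 i μ x') (ksC' L a m2 i) (ksDH' L a m2 i ν y')
          - triple (ksDH L a m2 i μ (underPtN L i.j i.n (ksU L i) x')) (ksC L a m2 i) (ksDH L a m2 i ν (underPtN L i.j i.n (ksU L i) y'))|
        ≤ C * (((L : ℝ) ^ (-(γ / 2))) ^ i.j)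
          * Real.exp (-(δ * tdistT (ksU L i) (blockOf (L ^ i.j) (ksU L i) (underPtN L i.j i.n (ksU L i) x'))
              (blockOf (L ^ i.j) (ksU L i) (underPtN L i.j i.n (ksU L i) y')))) := by
  have hL1 : 1 ≤ L := by omega
  obtain ⟨δ₂, cD, hδ₂, hcD, Ddec⟩ := ksDH_decay_unif (d := d) L hLodd hL ha hm0
  obtain ⟨RD, δ₃, hRD, hδ₃, Drate⟩ := ksDH_rate_unif (d := d) L hLodd hL ha hm0 hγ0 hγ1
  have hcC := ksC_const_pos (d := d) L hL ha
  obtain ⟨hκ', _⟩ := kapCT_pos_le (d := d + 1) ha hL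
  have hδ45 := delta45_pos (d := d + 1) ha hL
  have hK45 := K45_nonneg (d := d + 1) a L
  obtain ⟨κ, hκ, hκ₂, hκ₃, hκC, hκ45⟩ : ∃ κ : ℝ, 0 < κ ∧ κ ≤ δ₂ ∧ κ ≤ δ₃ ∧ κ ≤ kapCT (d + 1) a L ∧ κ ≤ delta45 (d + 1) a L := by
    refine ⟨min (min δ₂ δ₃) (min (kapCT (d + 1) a L) (delta45 (d + 1) a L)), lt_min (lt_min hδ₂ hδ₃) (lt_min hκ' hδ45), ?_, ?_, ?_, ?_⟩
    · exact (min_le_left _ _).trans (min_le_left _ _)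
    · exact (min_le_left _ _).trans (min_le_right _ _)
    · exact (min_le_right _ _).trans (min_le_left _ _)
    · exact (min_le_right _ _).trans (min_le_right _ _)
  have hs : 0 ≤ (L : ℝ) ^ (-(γ / 2)) := Real.rpow_nonneg (Nat.cast_nonneg _) _
  refine ⟨(RD * (gam0L (d + 1) a L - (kingRho (d + 1) a L + kingRhoB (d + 1) a L))⁻¹ * cD
        + cD * K45 (d + 1) a L * cD + cD * (gam0L (d + 1) a L - (kingRho (d + 1) a L + kingRhoB (d + 1) a L))⁻¹ * RD)
      * latticeConst (d + 1) (κ / 2) ^ 2 + 1, κ / 2, by positivity, half_pos hκ, fun m2 hm hcap i μ ν x' y' => ?_⟩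
  set cC : ℝ := (gam0L (d + 1) a L - (kingRho (d + 1) a L + kingRhoB (d + 1) a L))⁻¹ with hcC_def
  set V : ℝ := latticeConst (d + 1) (κ / 2) with hV_def
  set s : ℝ := (L : ℝ) ^ (-(γ / 2)) with hs_def
  set x := underPtN L i.j i.n (ksU L i) x' with hx
  set y := underPtN L i.j i.n (ksU L i) y' with hy
  set Bx := blockOf (L ^ i.j) (ksU L i) x with hBx
  set By := blockOf (L ^ i.j) (ksU L i) y with hBy
  have hBy' : blockOf (L ^ i.n * L ^ i.j) (ksU L i) y' = By := (blockOf_underPtN L i.j i.n (ksU L i) y').symm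
  have ht0 := tdistT_nonneg (ksU L i)
  have hRDs : 0 ≤ RD * s ^ i.j := mul_nonneg hRD.le (pow_nonneg hs _)
  have hKL : 0 ≤ K45 (d + 1) a L * ((L : ℝ) ^ i.j)⁻¹ := mul_nonneg hK45 (inv_nonneg.mpr (pow_nonneg (Nat.cast_nonneg (α := ℝ) L) i.j))
  have exp_rate_mono : ∀ {κ' r t : ℝ}, κ' ≤ r → 0 ≤ t → Real.exp (-(r * t)) ≤ Real.exp (-(κ' * t)) :=
    fun hκr ht => Real.exp_le_exp.mpr (neg_le_neg (mul_le_mul_of_nonneg_right hκr ht))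
  -- the six factor bounds at the common rate `κ`
  have hA : ∀ z, |ksDH L a m2 i μ x z| ≤ cD * Real.exp (-(κ * tdistT (ksU L i) Bx z)) := fun z =>
    ((Ddec m2 hm.le hcap i μ).1 x z).trans (mul_le_mul_of_nonneg_left (exp_rate_mono hκ₂ (ht0 _ _)) hcD.le)
  have hB' : ∀ w, |ksDH' L a m2 i ν y' w| ≤ cD * Real.exp (-(κ * tdistT (ksU L i) w By)) := fun w => by
    rw [tdistT_symm, ← hBy']
    exact ((Ddec m2 hm.le hcap i ν).2 y' w).trans (mul_le_mul_of_nonneg_left (exp_rate_mono hκ₂ (ht0 _ _)) hcD.le)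
  have hCm : ∀ z w, |ksC L a m2 i z w| ≤ cC * Real.exp (-(κ * tdistT (ksU L i) z w)) := fun z w =>
    ((ksC_decay L hL ha hm i z w).1).trans (mul_le_mul_of_nonneg_left (exp_rate_mono hκC (ht0 _ _)) hcC.le)
  have hCm' : ∀ z w, |ksC' L a m2 i z w| ≤ cC * Real.exp (-(κ * tdistT (ksU L i) z w)) := fun z w =>
    ((ksC_decay L hL ha hm i z w).2).trans (mul_le_mul_of_nonneg_left (exp_rate_mono hκC (ht0 _ _)) hcC.le)
  have hdA : ∀ z, |ksDH' L a m2 i μ x' z - ksDH L a m2 i μ x z| ≤ RD * s ^ i.j * Real.exp (-(κ * tdistT (ksU L i) Bx z)) :=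
    fun z => (Drate m2 hm hcap i μ x' z).trans (mul_le_mul_of_nonneg_left (exp_rate_mono hκ₃ (ht0 _ _)) hRDs)
  have hdB : ∀ w, |ksDH' L a m2 i ν y' w - ksDH L a m2 i ν y w| ≤ RD * s ^ i.j * Real.exp (-(κ * tdistT (ksU L i) w By)) :=
    fun w => by
    rw [tdistT_symm]
    exact (Drate m2 hm hcap i ν y' w).trans (mul_le_mul_of_nonneg_left (exp_rate_mono hκ₃ (ht0 _ _)) hRDs)
  have hdC : ∀ z w, |ksC' L a m2 i z w - ksC L a m2 i z w|
      ≤ K45 (d + 1) a L * ((L : ℝ) ^ i.j)⁻¹ * Real.exp (-(κ * tdistT (ksU L i) z w)) := fun z w =>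
    (ksC_rate L hL ha hm i z w).trans (mul_le_mul_of_nonneg_left (exp_rate_mono hκ45 (ht0 _ _)) hKL)
  have hVs : ∀ u : Tor (ksU L i), ∑ z, Real.exp (-(κ / 2 * tdistT (ksU L i) u z)) ≤ V := fun u =>
    tdistT_sumBound (ksU L i) (κ / 2) (half_pos hκ) u
  have key := triple_rate (tdistT (ksU L i)) ht0 (tdistT_triangle (ksU L i)) hκ.le hcD.le hRDs hcC.le hKL hcD.le hRDs
    hA hCm hCm' hB' hdA hdC hdB hVs
  have hE : 0 ≤ Real.exp (-(κ / 2 * tdistT (ksU L i) Bx By)) := (Real.exp_pos _).le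
  have hV0 : 0 ≤ V ^ 2 := sq_nonneg _
  have hLj : ((L : ℝ) ^ i.j)⁻¹ ≤ s ^ i.j := inv_pow_le_rate_pow hL1 (by linarith) i.j
  have hsj : 0 ≤ s ^ i.j := pow_nonneg hs _
  have hKs : cD * (K45 (d + 1) a L * ((L : ℝ) ^ i.j)⁻¹) * cD ≤ cD * (K45 (d + 1) a L * s ^ i.j) * cD :=
    mul_le_mul_of_nonneg_right (mul_le_mul_of_nonneg_left (mul_le_mul_of_nonneg_left hLj hK45) hcD.le) hcD.le
  have hsum : RD * s ^ i.j * cC * cD + cD * (K45 (d + 1) a L * ((L : ℝ) ^ i.j)⁻¹) * cD + cD * cC * (RD * s ^ i.j)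
      ≤ (RD * cC * cD + cD * K45 (d + 1) a L * cD + cD * cC * RD) * s ^ i.j := by
    calc RD * s ^ i.j * cC * cD + cD * (K45 (d + 1) a L * ((L : ℝ) ^ i.j)⁻¹) * cD + cD * cC * (RD * s ^ i.j)
        ≤ RD * s ^ i.j * cC * cD + cD * (K45 (d + 1) a L * s ^ i.j) * cD + cD * cC * (RD * s ^ i.j) := by linarith [hKs]
      _ = (RD * cC * cD + cD * K45 (d + 1) a L * cD + cD * cC * RD) * s ^ i.j := by ring
  calc |triple (ksDH' L a m2 i μ x') (ksC' L a m2 i) (ksDH' L a m2 i ν y') - triple (ksDH L a m2 i μ x) (ksC L a m2 i) (ksDH L a m2 i ν y)|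
      ≤ (RD * s ^ i.j * cC * cD + cD * (K45 (d + 1) a L * ((L : ℝ) ^ i.j)⁻¹) * cD + cD * cC * (RD * s ^ i.j)) * V ^ 2
          * Real.exp (-(κ / 2 * tdistT (ksU L i) Bx By)) := key
    _ ≤ (RD * cC * cD + cD * K45 (d + 1) a L * cD + cD * cC * RD) * s ^ i.j * V ^ 2 * Real.exp (-(κ / 2 * tdistT (ksU L i) Bx By)) :=
        mul_le_mul_of_nonneg_right (mul_le_mul_of_nonneg_right hsum hV0) hE
    _ = (RD * cC * cD + cD * K45 (d + 1) a L * cD + cD * cC * RD) * V ^ 2 * s ^ i.j * Real.exp (-(κ / 2 * tdistT (ksU L i) Bx By)) := by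
        ring
    _ ≤ ((RD * cC * cD + cD * K45 (d + 1) a L * cD + cD * cC * RD) * V ^ 2 + 1) * s ^ i.j
          * Real.exp (-(κ / 2 * tdistT (ksU L i) Bx By)) :=
        mul_le_mul_of_nonneg_right (mul_le_mul_of_nonneg_right (by linarith) hsj) hE

end Summit.QuantumFields.YangMills.BalabanUVNodes.N15KingModelRung.Curved
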